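import Summits.BirchSwinnertonDyer.Rank1Residual.Additive.CyclotomicThreeDescentData
import Literature.NumberTheory.EllipticCurves.QuadraticTwistRank
import Literature.NumberTheory.EllipticCurves.HeightsBaseChangeProofs
import Literature.NumberTheory.EllipticCurves.PAdicHeightsK
import Literature.NumberTheory.EllipticCurves.LeadingTermHeegnerProofs
import HarnessLib

/-!
# Rank `(0,1)` descent data over a quadratic field: the generator of `V(K)/tors` versus the
# generator of `V(F)/tors` (index divides `2`), and the transfer of the `p`-adic and Néron–Tate
# heights of the generator (line V17 of the additive sub-cell)

HONEST FRAMING (cell `b2b-bsdres`, run/shared/lean/b2b/bsd-rank1-residual/, verbatim in every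
file): the goal of the cell is to DELETE the COMBINATION-SHAPED residual classes of the
Birch–Swinnerton-Dyer formula for ALL analytic-rank `≤ 1` elliptic curves over `ℚ` — "full BSD
formula for every rank `≤ 1` curve in class `C`" assembled STRICTLY from published theorems — so
that the rank-`≤ 1` remainder becomes exactly the CONSTRUCTION-SHAPED classes, which are TYPED
(missing-input `Prop`s), NOT attempted. This is not "finishing BSD". Seat additive-p4, gen 7
(research route on X3/X4); labels UNCHANGED; nothing is booked here.

Theorems only (no `def`, no `sorry`, no named fact). Setting: `K/F` a quadratic extension of fields
(`2 ≠ 0`), `V/F` a Weierstrass curve such that BOTH `V(F)` and `V(K)` have a one-element Mordell–Weil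
basis (`{P₀}`, `{Q}`) — the `(r_W, r_V) = (0, 1)` rows of line V17 (`F = ℚ`, `K = ℚ(ζ₃)`,
`W ≅ V^{(−3)}` of rank `0`, so `rank V(K) = rank V(ℚ) + rank W(ℚ) = 1`, Silverman *AEC* Ex. 10.16,
tree `mordellWeilRank_baseChange_of_finrank_eq_two_of_finite`).

* `incl_generator_eq_zsmul_of_quadratic` — **`ι P₀ = m • Q + t` with `t` torsion and `m ∣ 2`.**
  Proof (Galois descent, no twisting map): the conjugation `σ` of `K/F` acts on `V(K)`
  (`QuadraticDescent.conjMap`), `σQ ≡ ±Q (mod tors)` since `{Q}` is a basis and `σ² = 1`; the sign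
  `−` would make `ι P₀ = σ(ι P₀) ≡ −ι P₀` torsion; so `σQ ≡ Q`, and `Q + σQ ≡ 2Q` is `σ`-fixed hence
  `F`-rational (`Quadratic.exists_eq_algebraMap_of_conj_eq`), `= ι(k P₀ + t₀) ≡ k m Q`, whence
  `k m = 2`.
* `padicHeightK_generator_eq` (`F = ℚ`) — for a `K`-height datum `DK` restricting to a `ℚ`-datum `D`
  (`DK.RestrictsTo D`, factor `[K:ℚ] = 2`): `m² · DK(Q,Q) = 2 · D(P₀,P₀)`;
* `heightPairing_generator_eq` (`F = ℚ`) — Néron–Tate: `m² · ⟨Q,Q⟩_K = 2 · ⟨P₀,P₀⟩_ℚ`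
  (`heightPairing_baseChange`, Silverman *AEC* VIII.5.4(b)); with `m ∣ 2` both ratios
  `⟨Q,Q⟩/⟨P₀,P₀⟩` lie in `{2, 1/2}` — `3`-adic units.

These feed the rank-`(0,1)` Euler-characteristic argument over `K = ℚ(ζ₃)`
(`XGordRankZeroOneCyclotomicThree.lean`): the `3`-adic height of the `K`-generator in Greenberg's
p. 110 display (`Greenberg1999.schneider_charCoeff_rankOne_quadraticBaseChange`) is a `3`-adic UNIT
multiple of the `ℚ`-regulator that Perrin-Riou's theorem compares with `L'(V,1)`, and the Néron–Tate
regulator of `V_K` in Milne's identity is a `3`-adic unit multiple of `Reg(V/ℚ)`.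
-/

noncomputable section

open scoped Classical

open WeierstrassCurve WeierstrassCurve.Affine.Point Literature.NumberTheory.EllipticCurves
  Literature.NumberTheory.QuadraticFields

namespace Summit.BirchSwinnertonDyer.Rank1Residual.Additive

/-! ## §1 One-element Mordell–Weil bases (any field) -/

section Basis

variable {F : Type*} [Field F] {E : WeierstrassCurve F}

/-- A one-element Mordell–Weil basis consists of a point of infinite order. [folklore] -/
theorem not_isOfFinAddOrder_of_isMordellWeilBasis_one {Q : E.toAffine.Point}
    (hQ : IsMordellWeilBasis (fun _ : Fin 1 => Q)) : ¬ IsOfFinAddOrder Q := by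
  intro hfin
  apply hQ.1.ne_zero (0 : Fin 1)
  simp only [Function.comp_apply]
  exact (QuotientAddGroup.eq_zero_iff _).mpr ((AddCommGroup.mem_torsion _).mpr hfin)

/-- Every point is an integer multiple of a one-element Mordell–Weil basis up to torsion. [folklore] -/
theorem exists_eq_zsmul_add_torsion_of_isMordellWeilBasis_one {Q : E.toAffine.Point}
    (hQ : IsMordellWeilBasis (fun _ : Fin 1 => Q)) (P : E.toAffine.Point) :
    ∃ (m : ℤ) (t : E.toAffine.Point), IsOfFinAddOrder t ∧ P = m • Q + t := by
  have hmem : (QuotientAddGroup.mk P : mordellWeilModTorsion E) ∈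
      Submodule.span ℤ (Set.range (QuotientAddGroup.mk ∘ (fun _ : Fin 1 => Q) :
        Fin 1 → mordellWeilModTorsion E)) := by
    rw [hQ.2]; exact Submodule.mem_top
  have hrange : Set.range (QuotientAddGroup.mk ∘ (fun _ : Fin 1 => Q) : Fin 1 → mordellWeilModTorsion E)
      = {QuotientAddGroup.mk Q} := by
    ext x
    simp only [Set.mem_range, Set.mem_singleton_iff, Function.comp_apply]
    exact ⟨fun ⟨_, h⟩ => h.symm, fun h => ⟨0, h.symm⟩⟩
  rw [hrange] at hmem
  obtain ⟨m, hm⟩ := Submodule.mem_span_singleton.mp hmem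
  refine ⟨m, -(m • Q) + P, ?_, by abel⟩
  have h1 : (QuotientAddGroup.mk (m • Q) : mordellWeilModTorsion E) = QuotientAddGroup.mk P := by
    rw [← hm, QuotientAddGroup.mk_zsmul]
  exact (AddCommGroup.mem_torsion _).mp (QuotientAddGroup.eq.mp h1)

end Basis

/-! ## §2 The index of `ι(V(F))` in `V(K)/tors` divides `2` (quadratic `K/F`, Galois descent) -/

section Index

variable {F : Type*} {K : Type*} [Field F] [Field K] [Algebra F K] [NeZero (2 : F)]
  (V : WeierstrassCurve F)

/-- **The index lemma.** `K/F` quadratic (`2 ≠ 0` in `F`), `V/F` with one-element Mordell–Weil bases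
`{P₀}` of `V(F)` and `{Q}` of `V(K)`. Then `ι P₀ = m • Q + t` with `t` torsion and `m ∣ 2`.
[cite: SilvermanAEC2009, Exercise 10.16] -/
theorem incl_generator_eq_zsmul_of_quadratic (h2 : Module.finrank F K = 2)
    {P₀ : V.toAffine.Point} (hP₀ : IsMordellWeilBasis (fun _ : Fin 1 => P₀))
    {Q : (V.baseChange K).toAffine.Point} (hQ : IsMordellWeilBasis (fun _ : Fin 1 => Q)) :
    ∃ (m : ℤ) (t : (V.baseChange K).toAffine.Point), IsOfFinAddOrder t ∧ m ∣ 2 ∧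
      QuadraticDescent.incl K V P₀ = m • Q + t := by
  -- the conjugation of `K/F` and its action on `V(K)`
  obtain ⟨θ, c, hθ, hc⟩ := Quadratic.exists_sq_eq_algebraMap (F := F) (K := K) h2
  have hσσ : ∀ z, Quadratic.conj h2 hθ hc (Quadratic.conj h2 hθ hc z) = z := Quadratic.conj_conj h2 hθ hc
  have hcjcj : ∀ P, QuadraticDescent.conjMap V (Quadratic.conj h2 hθ hc)
      (QuadraticDescent.conjMap V (Quadratic.conj h2 hθ hc) P) = P :=
    QuadraticDescent.conjMap_conjMap V hσσ
  have hcjι : ∀ P, QuadraticDescent.conjMap V (Quadratic.conj h2 hθ hc) (QuadraticDescent.incl K V P) =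
      QuadraticDescent.incl K V P := QuadraticDescent.conjMap_incl V (Quadratic.conj h2 hθ hc)
  -- fixed points of `σ` come from `F`
  have hfix : ∀ P : (V.baseChange K).toAffine.Point,
      QuadraticDescent.conjMap V (Quadratic.conj h2 hθ hc) P = P → ∃ a, QuadraticDescent.incl K V a = P := by
    rintro (_ | ⟨x, y, h⟩) hP
    · exact ⟨0, (_root_.map_zero (QuadraticDescent.incl K V)).trans Affine.Point.zero_def⟩
    · rw [Affine.Point.map_some, Affine.Point.some.injEq] at hP
      obtain ⟨a, ha⟩ := Quadratic.exists_eq_algebraMap_of_conj_eq h2 hθ hc hP.1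
      obtain ⟨b, hb⟩ := Quadratic.exists_eq_algebraMap_of_conj_eq h2 hθ hc hP.2
      exact QuadraticDescent.exists_incl_eq (K := K) V h ha.symm hb.symm
  -- torsion bookkeeping
  have htorsσ : ∀ t : (V.baseChange K).toAffine.Point, IsOfFinAddOrder t →
      IsOfFinAddOrder (QuadraticDescent.conjMap V (Quadratic.conj h2 hθ hc) t) :=
    fun t ht ↦ (QuadraticDescent.conjMap V (Quadratic.conj h2 hθ hc)).isOfFinAddOrder ht
  have htorsι : ∀ t : V.toAffine.Point, IsOfFinAddOrder t → IsOfFinAddOrder (QuadraticDescent.incl K V t) :=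
    fun t ht ↦ (QuadraticDescent.incl K V).isOfFinAddOrder ht
  have hQinf : ¬ IsOfFinAddOrder Q := not_isOfFinAddOrder_of_isMordellWeilBasis_one hQ
  have hP₀inf : ¬ IsOfFinAddOrder P₀ := not_isOfFinAddOrder_of_isMordellWeilBasis_one hP₀
  have hιP₀inf : ¬ IsOfFinAddOrder (QuadraticDescent.incl K V P₀) := by
    intro h
    apply hP₀inf
    obtain ⟨k, hk, hkP⟩ := (isOfFinAddOrder_iff_nsmul_eq_zero).mp h
    refine (isOfFinAddOrder_iff_nsmul_eq_zero).mpr ⟨k, hk, QuadraticDescent.incl_injective (K := K) V ?_⟩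
    rw [map_nsmul, _root_.map_zero]; exact hkP
  -- `ι P₀ = m Q + t`, `σ Q = j Q + t'`
  obtain ⟨m, t, ht, hmQ⟩ := exists_eq_zsmul_add_torsion_of_isMordellWeilBasis_one hQ
    (QuadraticDescent.incl K V P₀)
  obtain ⟨j, t', ht', hjQ⟩ := exists_eq_zsmul_add_torsion_of_isMordellWeilBasis_one hQ
    (QuadraticDescent.conjMap V (Quadratic.conj h2 hθ hc) Q)
  refine ⟨m, t, ht, ?_, hmQ⟩
  -- `j = ±1`: `Q = σσQ = j² Q + (j σ t' + t')`
  have hj : j = 1 ∨ j = -1 := by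
    have e : Q = (j * j) • Q + (j • t' + QuadraticDescent.conjMap V (Quadratic.conj h2 hθ hc) t') := by
      conv_lhs => rw [← hcjcj Q, hjQ, map_add, map_zsmul, hjQ]
      rw [mul_zsmul, zsmul_add]
      abel
    have e2 : (1 - j * j) • Q = j • t' + QuadraticDescent.conjMap V (Quadratic.conj h2 hθ hc) t' := by
      rw [sub_zsmul, one_zsmul]
      nth_rewrite 1 [e]
      abel
    have htor : IsOfFinAddOrder ((1 - j * j) • Q) := by
      rw [e2]
      exact (ht'.zsmul).add (htorsσ t' ht')
    by_contra hne
    have h1 : (1 - j * j) ≠ 0 := by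
      intro h0
      have hjj : j * j = 1 := by linarith
      rcases Int.eq_one_or_neg_one_of_mul_eq_one hjj with h | h
      · exact hne (Or.inl h)
      · exact hne (Or.inr h)
    exact hQinf (isOfFinAddOrder_of_zsmul h1 htor)
  rcases hj with hj1 | hjm1
  · -- `σQ = Q + t'`: `Q + σQ` is fixed, equals `ι a`, `a = k P₀ + t₀`
    subst hj1
    rw [one_zsmul] at hjQ
    have hfixed : QuadraticDescent.conjMap V (Quadratic.conj h2 hθ hc)
        (Q + QuadraticDescent.conjMap V (Quadratic.conj h2 hθ hc) Q) =
        Q + QuadraticDescent.conjMap V (Quadratic.conj h2 hθ hc) Q := by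
      rw [map_add, hcjcj, add_comm]
    obtain ⟨a, ha⟩ := hfix _ hfixed
    obtain ⟨k, t₀, ht₀, hka⟩ := exists_eq_zsmul_add_torsion_of_isMordellWeilBasis_one hP₀ a
    have e2 : QuadraticDescent.incl K V a = (k * m) • Q + (k • t + QuadraticDescent.incl K V t₀) := by
      rw [hka, map_add, map_zsmul, hmQ, mul_zsmul, zsmul_add]; abel
    have e3 : (2 : ℤ) • Q = (k * m) • Q + (k • t + QuadraticDescent.incl K V t₀) - t' := by
      rw [← e2, ha, hjQ, two_zsmul]; abel
    have e : ((2 : ℤ) - k * m) • Q = k • t + QuadraticDescent.incl K V t₀ - t' := by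
      rw [sub_zsmul, e3]; abel
    have htor : IsOfFinAddOrder (((2 : ℤ) - k * m) • Q) := by
      rw [e, sub_eq_add_neg]
      exact ((ht.zsmul).add (htorsι t₀ ht₀)).add ht'.neg
    have h0 : (2 : ℤ) - k * m = 0 := by
      by_contra hne
      exact hQinf (isOfFinAddOrder_of_zsmul hne htor)
    exact Dvd.intro_left k (by linarith)
  · -- `σQ = -Q + t'` contradicts `ι P₀` non-torsion
    subst hjm1
    exfalso
    apply hιP₀inf
    have e2 : QuadraticDescent.conjMap V (Quadratic.conj h2 hθ hc) (QuadraticDescent.incl K V P₀) =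
        -(m • Q) + (m • t' + QuadraticDescent.conjMap V (Quadratic.conj h2 hθ hc) t) := by
      rw [hmQ, map_add, map_zsmul, hjQ, neg_one_zsmul, zsmul_add, zsmul_neg]; abel
    have e : (2 : ℤ) • QuadraticDescent.incl K V P₀ =
        t + (m • t' + QuadraticDescent.conjMap V (Quadratic.conj h2 hθ hc) t) := by
      rw [two_zsmul]
      nth_rewrite 2 [← hcjι P₀]
      rw [e2, hmQ]; abel
    have htor : IsOfFinAddOrder ((2 : ℤ) • QuadraticDescent.incl K V P₀) := by
      rw [e]
      exact ht.add ((ht'.zsmul).add (htorsσ t ht))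
    exact isOfFinAddOrder_of_zsmul two_ne_zero htor

end Index

/-! ## §3 Height transfer along `ι : V(ℚ) ↪ V(K)` for the generators (`F = ℚ`) -/

section Heights

variable (K : Type) [Field K] [NumberField K] (V : WeierstrassCurve ℚ) [V.IsElliptic]

omit [NumberField K] [V.IsElliptic] in
/-- A pairing vanishing on torsion in each variable is unchanged by adding torsion:
`B(mQ + t, mQ + t) = m² B(Q,Q)`. [folklore] -/
theorem pairing_zsmul_add_torsion_self {A R : Type*} [AddCommGroup A] [CommRing R]
    (B : A →+ A →+ R) (htors : ∀ P Q, IsOfFinAddOrder P → B P Q = 0)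
    (hsymm : ∀ P Q, B P Q = B Q P) (m : ℤ) (Q t : A) (ht : IsOfFinAddOrder t) :
    B (m • Q + t) (m • Q + t) = (m : R) ^ 2 * B Q Q := by
  have h1 : B (m • Q + t) t = 0 := by rw [hsymm]; exact htors t _ ht
  have h2 : B t (m • Q) = 0 := htors t _ ht
  calc B (m • Q + t) (m • Q + t)
      = B (m • Q + t) (m • Q) + B (m • Q + t) t := by rw [map_add]
    _ = B (m • Q) (m • Q) + B t (m • Q) + 0 := by rw [h1, map_add, AddMonoidHom.add_apply]
    _ = (m : R) ^ 2 * B Q Q := by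
        rw [h2, add_zero, add_zero, map_zsmul (B (m • Q)), hsymm (m • Q) Q, map_zsmul (B Q), smul_smul,
          zsmul_eq_mul]
        push_cast
        ring

omit [V.IsElliptic] in
/-- **`p`-adic heights of the two generators.** For a `K`-height datum `DK` restricting to a
`ℚ`-datum `D` (`DK.RestrictsTo D`: `DK(ιP, ιQ) = [K:ℚ]·D(P,Q)`), `[K:ℚ] = 2`, and
`ι P₀ = m • Q + t` with `t` torsion: `m² · DK(Q,Q) = 2 · D(P₀,P₀)`.
[cite: MazurTateTeitelbaum1986Invent, §II.4] -/
theorem padicHeightK_generator_eq {p : ℕ} [Fact p.Prime] (DK : PAdicHeightDataK V p K)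
    (D : PAdicHeightData V p) (hres : DK.RestrictsTo D) (h2 : Module.finrank ℚ K = 2)
    {P₀ : V.toAffine.Point} {Q : (V.baseChange K).toAffine.Point} {m : ℤ}
    {t : (V.baseChange K).toAffine.Point} (ht : IsOfFinAddOrder t)
    (hmQ : V.pointToBaseChange K P₀ = m • Q + t) :
    (m : ℚ_[p]) ^ 2 * DK.pairing Q Q = 2 * D.pairing P₀ P₀ := by
  have h := hres P₀ P₀
  rw [h2, hmQ, pairing_zsmul_add_torsion_self DK.pairing DK.map_torsion DK.symm m Q t ht] at h
  rw [h]
  norm_num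

omit [V.IsElliptic] in
/-- The inclusion of `PAdicHeightsK` is Mathlib's base-change map on points. [folklore] -/
theorem pointToBaseChange_eq_baseChange (P : V.toAffine.Point) :
    V.pointToBaseChange K P = Affine.Point.baseChange (W' := V) ℚ K P := by
  rcases P with _ | ⟨x, y, h⟩
  · rfl
  · rfl

/-- **Néron–Tate heights of the two generators**: if `ι P₀ = m • Q + t` with `t` torsion then
`m² · ⟨Q,Q⟩_K = [K:ℚ] · ⟨P₀,P₀⟩_ℚ = 2 · ⟨P₀,P₀⟩_ℚ` (heights relative to `K` restrict with the factor
`[K:ℚ]`, Silverman *AEC* VIII.5.4(b); the pairing kills torsion). [cite: SilvermanAEC2009, Prop. VIII.5.4(b)] -/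
theorem heightPairing_generator_eq (h2 : Module.finrank ℚ K = 2)
    {P₀ : V.toAffine.Point} {Q : (V.baseChange K).toAffine.Point} {m : ℤ}
    {t : (V.baseChange K).toAffine.Point} (ht : IsOfFinAddOrder t)
    (hmQ : V.pointToBaseChange K P₀ = m • Q + t) :
    (m : ℝ) ^ 2 * heightPairing Q Q = 2 * heightPairing P₀ P₀ := by
  have h0 := heightPairing_baseChange (R := ℚ) (K := ℚ) (L := K) (W := V) P₀ P₀
  have h : heightPairing (V.pointToBaseChange K P₀) (V.pointToBaseChange K P₀) =
      (Module.finrank ℚ K : ℝ) * heightPairing P₀ P₀ := by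
    rw [pointToBaseChange_eq_baseChange]; exact h0
  rw [h2, hmQ] at h
  -- `⟨mQ + t, mQ + t⟩ = m² ⟨Q,Q⟩`
  have e1 : ∀ R : (V.baseChange K).toAffine.Point, heightPairing R (m • Q + t) = (m : ℝ) * heightPairing R Q := by
    intro R
    rw [heightPairing_add_right, heightPairing_zsmul_right,
      heightPairing_eq_zero_of_isOfFinAddOrder_right R ht, add_zero]
  rw [e1, heightPairing_symm, e1] at h
  push_cast at h
  linarith [h]

end Heights

end Summit.BirchSwinnertonDyer.Rank1Residual.Additive

end
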